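import Summits.Langlands.Langlands.Theses.ParityBlindBianchi

/-!
# `ArtinWeightRealisationEven` (R″, stmt-Langlands-16619): the binder `Finite σ.toMonoidHom.range` is redundant

Negative-side lemma (crux disprover `cdisprove-stmt-Langlands-16619`, cycle 1, 2026-08-17; supports
stmt-Langlands-16619; workfile `Cruxes/ArtinWeightRealisationEven/Disproof.lean` §a5).

Hypothesis mutation "drop `Finite σ.toMonoidHom.range`".  In R″ the representation
`σ : Γ_K →ₜ* GL₂(ℚ̄_p)` is tied to `ρ : Γ_ℚ →ₜ* GL₂(ℂ)` by the entrywise model relation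
`ι ((σ g)_{ij}) = (ρ (g|_{ℚ̄}))_{ij}`.  A continuous `ρ` into `GL₂(ℂ)` has finite image
(`ArtinRep.finite_range_holds`: `Γ_ℚ` profinite, `GL₂(ℂ)` has no small subgroups), and the matrix
of `σ g` is the entrywise `ι⁻¹`-image of the matrix of `ρ(g|_{ℚ̄})`, so `σ` has finite image too
(`finite_range_of_model`).  Hence R″ implies its own mutation with the finite-image binder deleted
(`withoutFinite_of_artinWeightRealisationEven`; the converse is specialisation): the binder is
information-free for the prover and removable for the planner.  No definition, no named fact.
-/

noncomputable section

set_option linter.dupNamespace false -- `Summit.Langlands.Langlands` is the mandated namespace (D-0017)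

namespace Summit.Langlands.Langlands.Theorems.ArtinWeightRealisationEven.Negative

open Literature.NumberTheory.GaloisRepresentations

/-- **The model relation forces finite image.**  If `σ : Γ_K →ₜ* GL₂(ℚ̄_p)` is the entrywise
`ι`-model of `ρ|_{Γ_K}` for a continuous `ρ : Γ_ℚ →ₜ* GL₂(ℂ)`, then `σ` has finite image: the
image of `ρ` is finite (`ArtinRep.finite_range_holds`, transported to `GL₂(ℂ)` by
`FramedRep.finite_range_toContinuousRep_iff`) and `g ↦ (σ g : Matrix)` factors through it by the
entrywise map `ι⁻¹`. [folklore] -/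
theorem finite_range_of_model {p : ℕ} [Fact p.Prime] (ι : PadicAlgCl p ≃+* ℂ)
    (ρ : FramedGaloisRep ℚ ℂ 2) (K : Type) [Field K] [NumberField K]
    (σ : FramedGaloisRep K (PadicAlgCl p) 2)
    (hmodel : ∀ (g : Field.absoluteGaloisGroup K) (i j : Fin 2),
      ι ((σ g).val i j) = ((FramedGaloisRep.restrictField K ρ) g).val i j) :
    Finite σ.toMonoidHom.range := by
  have hρ : (Set.range (ρ : Field.absoluteGaloisGroup ℚ → GL (Fin 2) ℂ)).Finite :=
    (FramedRep.finite_range_toContinuousRep_iff ρ).mp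
      (ArtinRep.finite_range_holds (K := ℚ) (V := Fin 2 → ℂ) (FramedRep.toContinuousRep ρ))
  let f : GL (Fin 2) ℂ → Matrix (Fin 2) (Fin 2) (PadicAlgCl p) :=
    fun M => (M : Matrix (Fin 2) (Fin 2) ℂ).map ι.symm
  have hval : ∀ g : Field.absoluteGaloisGroup K,
      ((σ g : GL (Fin 2) (PadicAlgCl p)) : Matrix (Fin 2) (Fin 2) (PadicAlgCl p)) =
        f (ρ (absGaloisRestrict ℚ K g)) := by
    intro g
    ext i j
    have h1 := hmodel g i j
    rw [FramedGaloisRep.restrictField_apply] at h1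
    simp only [f, Matrix.map_apply]
    rw [← h1, RingEquiv.symm_apply_apply]
  have hsub : Set.range (fun g : Field.absoluteGaloisGroup K =>
      ((σ g : GL (Fin 2) (PadicAlgCl p)) : Matrix (Fin 2) (Fin 2) (PadicAlgCl p))) ⊆
        f '' Set.range (ρ : Field.absoluteGaloisGroup ℚ → GL (Fin 2) ℂ) := by
    rintro _ ⟨g, rfl⟩
    exact ⟨ρ (absGaloisRestrict ℚ K g), ⟨_, rfl⟩, (hval g).symm⟩
  have hfinM := (hρ.image f).subset hsub
  have hrange : Set.range (fun g : Field.absoluteGaloisGroup K =>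
      ((σ g : GL (Fin 2) (PadicAlgCl p)) : Matrix (Fin 2) (Fin 2) (PadicAlgCl p))) =
        Units.val '' Set.range (σ : Field.absoluteGaloisGroup K → GL (Fin 2) (PadicAlgCl p)) := by
    rw [← Set.range_comp]
    rfl
  rw [hrange] at hfinM
  have hfinσ : (Set.range (σ : Field.absoluteGaloisGroup K → GL (Fin 2) (PadicAlgCl p))).Finite :=
    hfinM.of_finite_image Units.val_injective.injOn
  have h4 : (σ.toMonoidHom.range : Set (GL (Fin 2) (PadicAlgCl p))) = Set.range σ := by
    rw [MonoidHom.coe_range]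
    rfl
  exact Set.finite_coe_iff.mpr (h4 ▸ hfinσ)

/-- **R″ implies R″ with the binder `Finite σ.toMonoidHom.range` deleted** (displayed verbatim: the
route decl `ParityBlindBianchi.ArtinWeightRealisationEven` with that one hypothesis removed): the
finite image is supplied by `finite_range_of_model`.  Tightness lemma — the binder is redundant.
[folklore] -/
theorem withoutFinite_of_artinWeightRealisationEven
    (h : Summit.Langlands.Langlands.Theses.ParityBlindBianchi.ArtinWeightRealisationEven) :
    ∀ (p : ℕ) [Fact p.Prime] (ι : PadicAlgCl p ≃+* ℂ) (ρ : Literature.NumberTheory.GaloisRepresentations.FramedGaloisRep ℚ ℂ 2), ρ.toGaloisRep.IsIrreducible → Nonempty ((Matrix.ProjGenLinGroup.mk.comp ρ.toMonoidHom).range ≃* alternatingGroup (Fin 5)) → (∀ (φ : ℚ →+* ℝ) (c : Field.absoluteGaloisGroup ℚ), Literature.NumberTheory.GaloisRepresentations.IsComplexConjugation φ c → Matrix.GeneralLinearGroup.det (ρ c) = 1) → ∀ (K : Type) [Field K] [NumberField K], NumberField.IsTotallyComplex K → Module.finrank ℚ K = 2 → ∀ (σ : Literature.NumberTheory.GaloisRepresentations.FramedGaloisRep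 K (PadicAlgCl p) 2), (∀ (g : Field.absoluteGaloisGroup K) (i j : Fin 2), ι ((σ g).val i j) = ((Literature.NumberTheory.GaloisRepresentations.FramedGaloisRep.restrictField K ρ) g).val i j) → σ.toGaloisRep.IsIrreducible → ∀ S₀ : Finset ℕ, p ∈ S₀ → (0 : ℕ) ∉ S₀ → (∃ (U : Subgroup (GL (Fin 2) (IsDedekindDomain.FiniteAdeleRing (NumberField.RingOfIntegers K) K))) (ϖ : ∀ v : IsDedekindDomain.HeightOneSpectrum (NumberField.RingOfIntegers K), (v.adicCompletion K)ˣ) (a : {v : IsDedekindDomain.HeightOneSpectrum (NumberField.RingOfIntegers K) // ∀ ℓ ∈ S₀, ((ℓ : ℕ) : NumberField.RingOfIntegers K) ∉ v.asIdeal} → ℕ → (Valued.v (R := PadicAlgCl p)).valuationSubring), IsOpen (U : Set (GL (Fin 2) (IsDedekindDomain.FiniteAdeleRing (NumberField.RingOfIntegers K) K))) ∧ U ≤ Literature.NumberTheory.Automorphic.glFiniteIntegralLevel 2 K ∧ (∀ g ∈ Literature.NumberTheory.Automorphic.glFiniteIntegralLevel 2 K, (∀ v : IsDedekindDomain.HeightOneSpectrum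 (NumberField.RingOfIntegers K), ¬ (∀ ℓ ∈ S₀, ((ℓ : ℕ) : NumberField.RingOfIntegers K) ∉ v.asIdeal) → ∀ i j : Fin 2, ((g : Matrix (Fin 2) (Fin 2) (IsDedekindDomain.FiniteAdeleRing (NumberField.RingOfIntegers K) K)) i j) v = (1 : Matrix (Fin 2) (Fin 2) (v.adicCompletion K)) i j) → g ∈ U) ∧ (∀ v : IsDedekindDomain.HeightOneSpectrum (NumberField.RingOfIntegers K), Valued.v ((ϖ v : (v.adicCompletion K)ˣ) : v.adicCompletion K) = WithZero.exp (-1 : ℤ)) ∧ Literature.NumberTheory.Automorphic.IsHeckePoint (Matrix.GeneralLinearGroup.map (n := Fin 2) (algebraMap K (IsDedekindDomain.FiniteAdeleRing (NumberField.RingOfIntegers K) K))) (Literature.NumberTheory.Automorphic.LevelTower.ofSeq U (fun r : ℕ => (Literature.NumberTheory.Automorphic.principalCongruenceLevel 2 K (Ideal.span {((p : ℕ) : NumberField.RingOfIntegers K)} ^ r)).map (Literature.NumberTheory.Automorphic.GLn.sndHom 2 K))) ((p : ℕ) : (Valued.v (R := PadicAlgCl p)).valuationSubring) (fun j : {v :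 IsDedekindDomain.HeightOneSpectrum (NumberField.RingOfIntegers K) // ∀ ℓ ∈ S₀, ((ℓ : ℕ) : NumberField.RingOfIntegers K) ∉ v.asIdeal} × Fin 2 => Literature.NumberTheory.Automorphic.GLn.sndHom 2 K (Literature.NumberTheory.Automorphic.heckeDiagAt 2 K j.1.1 (ϖ j.1.1) (j.2.val + 1))) (fun j => a j.1 (j.2.val + 1)) ∧ ∀ (v : IsDedekindDomain.HeightOneSpectrum (NumberField.RingOfIntegers K)) (hv : ∀ ℓ ∈ S₀, ((ℓ : ℕ) : NumberField.RingOfIntegers K) ∉ v.asIdeal), σ.IsHeckeAssociatedAt v (fun i : ℕ => if i = 0 then (1 : PadicAlgCl p) else ((a ⟨v, hv⟩ i : (Valued.v (R := PadicAlgCl p)).valuationSubring) : PadicAlgCl p))) → ∃ (hcpt : Literature.NumberTheory.Automorphic.isCompact_glFiniteIntegralLevel 2 K) (π : Literature.NumberTheory.Automorphic.CuspidalAutomorphicRepData 2 K hcpt), ∀ w : IsDedekindDomain.HeightOneSpectrum (NumberField.RingOfIntegers K), (∀ ℓ ∈ S₀, ((ℓ : ℕ) : NumberField.RingOfIntegers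 K) ∉ w.asIdeal) → SatakeFrobCompatibleAt ι π.1 σ w :=
  fun p _ ι ρ hirr hA5 heven K _ _ htc hdeg σ hmodel hirrσ S₀ hp h0 hyp =>
    h p ι ρ hirr hA5 heven K htc hdeg σ hmodel (finite_range_of_model ι ρ K σ hmodel) hirrσ S₀ hp h0 hyp

end Summit.Langlands.Langlands.Theorems.ArtinWeightRealisationEven.Negative

end
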